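import Summits.QuantumFields.BalabanUV.Beta.FP.TowerK2bDefectBrickDoor

/-!
# `BalabanUV.Beta.FP.TowerK2bDoorGapTelescope` — binder row D1 ∕ (C1) OWNER «beta-an2», PART 38: **THE DOOR GAP IS THE `H`-SANDWICH OF THE LEGS' INTERTWINING
# DEFECT; THE DEFECT IS LEIBNIZ UNDER COMPOSITION OF TRANSPORTS; HENCE DOOR GAPS TELESCOPE DOWN THE TOWER** — door (ii) (Q-FP-47-1's answer, ruling request
# R-AN2-73-1, packet `HOME/b2b-balaban-beta-an2/gen73/R-AN2-73-1-PACKET.md` §5 (b)∕(c)) composed over any number of storeys as ONE hypothesis-free matrix identity,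
# over the letters of PART 37 `TowerK2bDefectBrickDoor` VERBATIM

WHY.  PART 37 §3 types the one-storey word of door (ii): the top storey of the END wrapper's Ward defect is `w •` the DOOR GAP
`gap(L̂; E, E′; H) := [E, L̂ᵀ·H·L̂] − L̂ᵀ·[E′, H]·L̂` of the leg matrix `L̂ : Matrix τ ι ℝ` (row `b` = the transport of brick `b` to the finer index), the fine generator
`E = diagonal d` on `ι` and the brick-level generator `E′ = diagonal d′` on `τ` («fine door of the transported brick» minus «transported brick-level door»); road «FP»
`TowerK2bDefectDoorGaps` (p631115) instantiates it at the window letters and `TowerK2bDefectClosed.def_allDepths` (p625806) composes it down the tower by a recursion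
with scalar chain weights.  THIS FILE types the same composition in the NESTED-CONGRUENCE presentation, with no hypothesis and over heterogeneous brick index types
`ι ← τ ← υ ← ω` (fine ← storey-1 bricks ← storey-2 bricks ← storey-3 bricks):
§1 **`doorGap_eq_intertwiner_sandwich`** — with the legs' INTERTWINING DEFECT `K := L̂·E − E′·L̂ : Matrix τ ι ℝ` (zero iff the legs carry the fine door onto the brick-level
door), `gap(L̂; E, E′; H) = Kᵀ·H·L̂ − L̂ᵀ·H·K` — the door gap is the `H`-sandwich of `K` against the legs (PART 36's D-word `D b x = (λ(pr x) − λ(rt b))·L b x` is `K`'s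
entry table: §5 `intertwiner_eq_of_Dword`);
§2 **`intertwiner_comp`** — LEIBNIZ: `K(L̂₂·L̂₁; E₀, E₂) = L̂₂·K(L̂₁; E₀, E₁) + K(L̂₂; E₁, E₂)·L̂₁` for ANY intermediate generator `E₁` on the middle bricks;
§3 **`doorGap_comp`** — THE TELESCOPE: `gap(L̂₂·L̂₁; E₀, E₂; H) = gap(L̂₁; E₀, E₁; L̂₂ᵀ·H·L̂₂) + L̂₁ᵀ·gap(L̂₂; E₁, E₂; H)·L̂₁` — «conjugate the composite minus compose the
conjugates» is the SUM OF THE STOREY GAPS, each transported by the legs below it; **`doorGap_comp₃`** the three-storey display (iterate §3 for any depth);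
§4 **`doorGap_eq_zero_of_intertwine`** — if the legs INTERTWINE the two generators (`L̂·E = E′·L̂`: PART 36 §3's root-consistency in matrix letters) the door gap
vanishes for EVERY brick table; `doorGap_comp_of_intertwine_low ∕ _top` — with one intertwining storey the composite gap is the other storey's gap, transported;
§5 **`intertwiner_eq_of_Dword`**, **`topDefect_eq_smul_intertwiner_sandwich`** — the junction to PART 36∕37's leg-FUNCTION letters: `Matrix.of L·E_λ − E_rt·Matrix.of L
= Matrix.of D` and PART 37's `topDefect_eq_smul_doorGap` left side `= w • (D̂ᵀ·H·L̂ − L̂ᵀ·H·D̂)`.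
READING (zero weight; nothing asserted): door (ii) says the law's order-2 word for a transported brick carries the brick-level door `L̂ᵀ[E′,H]L̂`; by §1 the price of
the finest door instead is exactly the `K`-sandwich, by §2–§3 the price at composite depth is the transported sum of every storey's `K`-sandwich, and by §4 it is
zero precisely on storeys whose legs intertwine — which by value they do not (Engine C K2L-OVL 3f3ca9a4efdb6ae3: `ρ_ovl = 0.434`, zero weight on any binder).
[folklore] `Matrix` algebra BY NAME over abstract finite index types; no `def`, no `def … : Prop`, nothing cited, 0 sorry; DISJOINT from road «FP» g50's planned
`TowerK2bDefectStoreySum` (composite legs to the finest index with scalar chain weights `compLinKer`; neither file imports the other).  Nothing of Bałaban's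
asserted, valued or discharged; door (ii) is NOT typed as a law here (law owner ∕ REFEREE, R-AN2-73-1); (J-R₂″) NOT claimed either way; no door gap claimed to
vanish at the record; 0∕4 row-D1 binders (hW ∕ hR ∕ D1Tel ∕ D1Rep); NOT (C1), NOT (T-ID), NOT D1, NEVER «G-an2-4 closed», NOT BetaPertH, NOT continuum, NOT Clay.
HONEST DEPENDENCY (page 1, mandatory): continuum YM on T⁴ ⇐ BetaPertH ∧ nine spine estimates (0/9 proved); BetaPertH ⇐ (D1) ∧ (D4) ∧ CAP+tail;
G-an2-4 gates asym, D1 and NE2/3/4.  HONEST FRAMING (cell contract, verbatim): «discharging `BetaPertH` makes Bałaban's UV stability UNCONDITIONAL —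
a real constructive-QFT result; it is NOT the continuum limit and NOT the Clay problem.»  ABSOLUTE RULE (cell charter, verbatim): «No internally-minted
statement may enter as a cited fact. Every hypothesis is either kernel-proved in this package or a verbatim quotation of a PUBLISHED theorem with page
reference. The manuscript(s) under audit are NOT citable for their own disputed steps — they are the thing under adjudication; programme-internal
(2001/route/tribunal) claims are never citable.»  Row D1 ∕ (C1) OWNER, b2b-balaban-beta-an2 gen 74, 2026-08-28.  No existing file touched.
-/

noncomputable section

open scoped BigOperators

namespace Summit.QuantumFields.BalabanUV.Beta.FP.TowerK2bDoorGapTelescope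

open Finset Matrix
open Summit.QuantumFields.BalabanUV.Beta.FP.TowerK2bDefectBrickDoor (topDefect_eq_smul_doorGap)

variable {ι σ τ υ ω : Type*} [Fintype ι] [DecidableEq ι] [Fintype τ] [DecidableEq τ] [Fintype υ] [DecidableEq υ] [Fintype ω] [DecidableEq ω]

/-! ## §1 The door gap is the `H`-sandwich of the legs' intertwining defect -/

omit [Fintype υ] [DecidableEq υ] [Fintype ω] [DecidableEq ω] in
/-- [folklore] **`doorGap_eq_intertwiner_sandwich`**: for legs `L̂ : Matrix τ ι ℝ`, a brick table `H : Matrix τ τ ℝ`, the fine generator `E = diagonal d` and the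
brick-level generator `E′ = diagonal d′`, the DOOR GAP `[E, L̂ᵀHL̂] − L̂ᵀ[E′,H]L̂` equals `Kᵀ·H·L̂ − L̂ᵀ·H·K` with the INTERTWINING DEFECT `K := L̂·E − E′·L̂`. -/
theorem doorGap_eq_intertwiner_sandwich (d : ι → ℝ) (d' : τ → ℝ) (L : Matrix τ ι ℝ) (H : Matrix τ τ ℝ) :
    (Matrix.diagonal d * (Lᵀ * H * L) - (Lᵀ * H * L) * Matrix.diagonal d) - Lᵀ * (Matrix.diagonal d' * H - H * Matrix.diagonal d') * L
      = (L * Matrix.diagonal d - Matrix.diagonal d' * L)ᵀ * H * L - Lᵀ * H * (L * Matrix.diagonal d - Matrix.diagonal d' * L) := by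
  rw [Matrix.transpose_sub, Matrix.transpose_mul, Matrix.transpose_mul, Matrix.diagonal_transpose, Matrix.diagonal_transpose]
  simp only [Matrix.mul_sub, Matrix.sub_mul, Matrix.mul_assoc]
  abel

/-! ## §2 The intertwining defect is Leibniz under composition of transports -/

omit [Fintype ω] [DecidableEq ω] in
/-- [folklore] **`intertwiner_comp` — LEIBNIZ**: for two storeys of legs `L̂₁ : Matrix τ ι ℝ` (storey-1 bricks ← fine) and `L̂₂ : Matrix υ τ ℝ` (storey-2 bricks ← storey-1
bricks) and generators `E₀ = diagonal d₀` (fine), `E₁ = diagonal d₁` (storey-1 roots), `E₂ = diagonal d₂` (storey-2 roots):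
`(L̂₂L̂₁)·E₀ − E₂·(L̂₂L̂₁) = L̂₂·(L̂₁E₀ − E₁L̂₁) + (L̂₂E₁ − E₂L̂₂)·L̂₁` — for ANY choice of the intermediate generator `E₁`. -/
theorem intertwiner_comp (d₀ : ι → ℝ) (d₁ : τ → ℝ) (d₂ : υ → ℝ) (L₁ : Matrix τ ι ℝ) (L₂ : Matrix υ τ ℝ) :
    L₂ * L₁ * Matrix.diagonal d₀ - Matrix.diagonal d₂ * (L₂ * L₁)
      = L₂ * (L₁ * Matrix.diagonal d₀ - Matrix.diagonal d₁ * L₁) + (L₂ * Matrix.diagonal d₁ - Matrix.diagonal d₂ * L₂) * L₁ := by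
  simp only [Matrix.mul_sub, Matrix.sub_mul, Matrix.mul_assoc]
  abel

/-! ## §3 The telescope: the composite door gap is the transported sum of the storey gaps -/

omit [Fintype ω] [DecidableEq ω] in
/-- [folklore] **`doorGap_comp` — DOOR GAPS TELESCOPE**: for the composite transport `L̂₂·L̂₁` of a storey-2 brick table `H : Matrix υ υ ℝ`,
`gap(L̂₂L̂₁; E₀, E₂; H) = gap(L̂₁; E₀, E₁; L̂₂ᵀHL̂₂) + L̂₁ᵀ·gap(L̂₂; E₁, E₂; H)·L̂₁`, `gap(L̂; E, E′; H) := [E, L̂ᵀHL̂] − L̂ᵀ[E′,H]L̂` — the gap between «transport the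
composite, then turn finely» and «turn the top bricks, then transport the composite» is the storey-1 gap of the TRANSPORTED table `L̂₂ᵀHL̂₂` plus the storey-2 gap of
`H` transported by the storey-1 legs; hypothesis-free, any intermediate generator `E₁`. -/
theorem doorGap_comp (d₀ : ι → ℝ) (d₁ : τ → ℝ) (d₂ : υ → ℝ) (L₁ : Matrix τ ι ℝ) (L₂ : Matrix υ τ ℝ) (H : Matrix υ υ ℝ) :
    (Matrix.diagonal d₀ * ((L₂ * L₁)ᵀ * H * (L₂ * L₁)) - ((L₂ * L₁)ᵀ * H * (L₂ * L₁)) * Matrix.diagonal d₀)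
        - (L₂ * L₁)ᵀ * (Matrix.diagonal d₂ * H - H * Matrix.diagonal d₂) * (L₂ * L₁)
      = ((Matrix.diagonal d₀ * (L₁ᵀ * (L₂ᵀ * H * L₂) * L₁) - (L₁ᵀ * (L₂ᵀ * H * L₂) * L₁) * Matrix.diagonal d₀)
            - L₁ᵀ * (Matrix.diagonal d₁ * (L₂ᵀ * H * L₂) - (L₂ᵀ * H * L₂) * Matrix.diagonal d₁) * L₁)
        + L₁ᵀ * ((Matrix.diagonal d₁ * (L₂ᵀ * H * L₂) - (L₂ᵀ * H * L₂) * Matrix.diagonal d₁)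
            - L₂ᵀ * (Matrix.diagonal d₂ * H - H * Matrix.diagonal d₂) * L₂) * L₁ := by
  rw [Matrix.transpose_mul]
  simp only [Matrix.mul_sub, Matrix.sub_mul, Matrix.mul_assoc]
  abel

/-- [folklore] **`doorGap_comp₃` — THREE STOREYS** (§3 iterated once; the depth of Engine C's K2L objects at `n = 1`): for legs `L̂₁ : Matrix τ ι ℝ`, `L̂₂ : Matrix υ τ ℝ`,
`L̂₃ : Matrix ω υ ℝ` and a storey-3 brick table `H : Matrix ω ω ℝ`, the composite door gap of `L̂₃·(L̂₂·L̂₁)` against `(E₀, E₃)` is the storey-1 gap of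
`(L̂₃L̂₂)ᵀH(L̂₃L̂₂)` plus the `L̂₁`-transport of the storey-2 gap of `L̂₃ᵀHL̂₃` plus the `L̂₂L̂₁`-transport of the storey-3 gap of `H`. -/
theorem doorGap_comp₃ (d₀ : ι → ℝ) (d₁ : τ → ℝ) (d₂ : υ → ℝ) (d₃ : ω → ℝ) (L₁ : Matrix τ ι ℝ) (L₂ : Matrix υ τ ℝ) (L₃ : Matrix ω υ ℝ) (H : Matrix ω ω ℝ) :
    (Matrix.diagonal d₀ * ((L₃ * (L₂ * L₁))ᵀ * H * (L₃ * (L₂ * L₁))) - ((L₃ * (L₂ * L₁))ᵀ * H * (L₃ * (L₂ * L₁))) * Matrix.diagonal d₀)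
        - (L₃ * (L₂ * L₁))ᵀ * (Matrix.diagonal d₃ * H - H * Matrix.diagonal d₃) * (L₃ * (L₂ * L₁))
      = ((Matrix.diagonal d₀ * (L₁ᵀ * (L₂ᵀ * (L₃ᵀ * H * L₃) * L₂) * L₁) - (L₁ᵀ * (L₂ᵀ * (L₃ᵀ * H * L₃) * L₂) * L₁) * Matrix.diagonal d₀)
            - L₁ᵀ * (Matrix.diagonal d₁ * (L₂ᵀ * (L₃ᵀ * H * L₃) * L₂) - (L₂ᵀ * (L₃ᵀ * H * L₃) * L₂) * Matrix.diagonal d₁) * L₁)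
        + L₁ᵀ * ((Matrix.diagonal d₁ * (L₂ᵀ * (L₃ᵀ * H * L₃) * L₂) - (L₂ᵀ * (L₃ᵀ * H * L₃) * L₂) * Matrix.diagonal d₁)
            - L₂ᵀ * (Matrix.diagonal d₂ * (L₃ᵀ * H * L₃) - (L₃ᵀ * H * L₃) * Matrix.diagonal d₂) * L₂) * L₁
        + (L₂ * L₁)ᵀ * ((Matrix.diagonal d₂ * (L₃ᵀ * H * L₃) - (L₃ᵀ * H * L₃) * Matrix.diagonal d₂)
            - L₃ᵀ * (Matrix.diagonal d₃ * H - H * Matrix.diagonal d₃) * L₃) * (L₂ * L₁) := by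
  rw [doorGap_comp d₀ d₂ d₃ (L₂ * L₁) L₃ H, doorGap_comp d₀ d₁ d₂ L₁ L₂ (L₃ᵀ * H * L₃)]

/-! ## §4 Intertwining legs have no door gap -/

omit [Fintype υ] [DecidableEq υ] [Fintype ω] [DecidableEq ω] in
/-- [folklore] **`doorGap_eq_zero_of_intertwine`**: if the legs INTERTWINE the two generators (`L̂·E = E′·L̂` — every leg entry `L̂ b x ≠ 0` has `d x = d′ b`: the fine index
`x` is turned exactly as the brick `b` it is transported from; PART 36 §3's root-consistency) then `[E, L̂ᵀHL̂] = L̂ᵀ[E′,H]L̂` for EVERY brick table `H`. -/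
theorem doorGap_eq_zero_of_intertwine (d : ι → ℝ) (d' : τ → ℝ) (L : Matrix τ ι ℝ) (H : Matrix τ τ ℝ) (hK : L * Matrix.diagonal d = Matrix.diagonal d' * L) :
    (Matrix.diagonal d * (Lᵀ * H * L) - (Lᵀ * H * L) * Matrix.diagonal d) - Lᵀ * (Matrix.diagonal d' * H - H * Matrix.diagonal d') * L = 0 := by
  rw [doorGap_eq_intertwiner_sandwich, hK, sub_self, Matrix.transpose_zero, Matrix.zero_mul, Matrix.zero_mul, Matrix.mul_zero, sub_zero]

omit [Fintype ω] [DecidableEq ω] in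
/-- [folklore] **`doorGap_comp_of_intertwine_low`**: if the LOWER storey's legs intertwine (`L̂₁E₀ = E₁L̂₁`), the composite door gap is the top storey's gap transported by
`L̂₁`: `gap(L̂₂L̂₁; E₀, E₂; H) = L̂₁ᵀ·gap(L̂₂; E₁, E₂; H)·L̂₁`. -/
theorem doorGap_comp_of_intertwine_low (d₀ : ι → ℝ) (d₁ : τ → ℝ) (d₂ : υ → ℝ) (L₁ : Matrix τ ι ℝ) (L₂ : Matrix υ τ ℝ) (H : Matrix υ υ ℝ)
    (hK₁ : L₁ * Matrix.diagonal d₀ = Matrix.diagonal d₁ * L₁) :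
    (Matrix.diagonal d₀ * ((L₂ * L₁)ᵀ * H * (L₂ * L₁)) - ((L₂ * L₁)ᵀ * H * (L₂ * L₁)) * Matrix.diagonal d₀)
        - (L₂ * L₁)ᵀ * (Matrix.diagonal d₂ * H - H * Matrix.diagonal d₂) * (L₂ * L₁)
      = L₁ᵀ * ((Matrix.diagonal d₁ * (L₂ᵀ * H * L₂) - (L₂ᵀ * H * L₂) * Matrix.diagonal d₁)
            - L₂ᵀ * (Matrix.diagonal d₂ * H - H * Matrix.diagonal d₂) * L₂) * L₁ := by
  rw [doorGap_comp d₀ d₁ d₂, doorGap_eq_zero_of_intertwine d₀ d₁ L₁ _ hK₁, zero_add]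

omit [Fintype ω] [DecidableEq ω] in
/-- [folklore] **`doorGap_comp_of_intertwine_top`**: if the TOP storey's legs intertwine (`L̂₂E₁ = E₂L̂₂`), the composite door gap is the lower storey's gap of the
transported table: `gap(L̂₂L̂₁; E₀, E₂; H) = gap(L̂₁; E₀, E₁; L̂₂ᵀHL̂₂)`. -/
theorem doorGap_comp_of_intertwine_top (d₀ : ι → ℝ) (d₁ : τ → ℝ) (d₂ : υ → ℝ) (L₁ : Matrix τ ι ℝ) (L₂ : Matrix υ τ ℝ) (H : Matrix υ υ ℝ)
    (hK₂ : L₂ * Matrix.diagonal d₁ = Matrix.diagonal d₂ * L₂) :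
    (Matrix.diagonal d₀ * ((L₂ * L₁)ᵀ * H * (L₂ * L₁)) - ((L₂ * L₁)ᵀ * H * (L₂ * L₁)) * Matrix.diagonal d₀)
        - (L₂ * L₁)ᵀ * (Matrix.diagonal d₂ * H - H * Matrix.diagonal d₂) * (L₂ * L₁)
      = (Matrix.diagonal d₀ * (L₁ᵀ * (L₂ᵀ * H * L₂) * L₁) - (L₁ᵀ * (L₂ᵀ * H * L₂) * L₁) * Matrix.diagonal d₀)
          - L₁ᵀ * (Matrix.diagonal d₁ * (L₂ᵀ * H * L₂) - (L₂ᵀ * H * L₂) * Matrix.diagonal d₁) * L₁ := by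
  rw [doorGap_comp d₀ d₁ d₂, doorGap_eq_zero_of_intertwine d₁ d₂ L₂ H hK₂, Matrix.mul_zero, Matrix.zero_mul, add_zero]

/-! ## §5 Junction to PART 36∕37's leg-function letters -/

variable [Fintype σ] [DecidableEq σ]

omit [Fintype υ] [DecidableEq υ] [Fintype ω] [DecidableEq ω] [Fintype σ] [DecidableEq σ] in
/-- [folklore] **`intertwiner_eq_of_Dword`**: with legs as a function `L : τ → ι → ℝ`, sites `pr : ι → σ`, roots `rt : τ → σ` and a gauge function `λ : σ → ℝ`, the
intertwining defect of `L̂ := Matrix.of L` against `E_λ = diagonal (λ ∘ pr)` and `E_rt = diagonal (λ ∘ rt)` is the table of PART 36's D-word: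
`L̂·E_λ − E_rt·L̂ = Matrix.of (fun b x => (λ(pr x) − λ(rt b))·L b x)`. -/
theorem intertwiner_eq_of_Dword (pr : ι → σ) (lam : σ → ℝ) (L : τ → ι → ℝ) (rt : τ → σ) :
    Matrix.of L * Matrix.diagonal (fun x => lam (pr x)) - Matrix.diagonal (fun b => lam (rt b)) * Matrix.of L
      = Matrix.of (fun b x => (lam (pr x) - lam (rt b)) * L b x) := by
  ext b x
  simp only [Matrix.sub_apply, Matrix.mul_diagonal, Matrix.diagonal_mul, Matrix.of_apply]
  ring

omit [Fintype υ] [DecidableEq υ] [Fintype ω] [DecidableEq ω] in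
/-- [folklore] **`topDefect_eq_smul_intertwiner_sandwich`** — PART 37's `topDefect_eq_smul_doorGap` LEFT SIDE VERBATIM (the top storey of the Ward defect, lower defects
zero) `= w • (D̂ᵀ·H·L̂ − L̂ᵀ·H·D̂)` with `D̂ := Matrix.of (fun b x => (λ(pr x) − λ(rt b))·L b x)` (PART 36's D-word as a matrix), `H := Matrix.of h`, `L̂ := Matrix.of L`:
the defect is the brick-weighted pairing of the legs with their own intertwining defect. -/
theorem topDefect_eq_smul_intertwiner_sandwich (pr : ι → σ) (lam : σ → ℝ) (h : τ → τ → ℝ) (L : τ → ι → ℝ) (rt : τ → σ) (w : ℝ) :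
    ∑ s, lam s • (w • ∑ b₁, ∑ b₂, h b₁ b₂ • (Matrix.vecMulVec (fun x => ((if pr x = s then (1 : ℝ) else 0) - (if rt b₁ = s then (1 : ℝ) else 0)) * L b₁ x) (L b₂)
              - Matrix.vecMulVec (L b₁) (fun z => ((if pr z = s then (1 : ℝ) else 0) - (if rt b₂ = s then (1 : ℝ) else 0)) * L b₂ z)))
      = w • ((Matrix.of (fun b x => (lam (pr x) - lam (rt b)) * L b x))ᵀ * Matrix.of h * Matrix.of L
              - (Matrix.of L)ᵀ * Matrix.of h * Matrix.of (fun b x => (lam (pr x) - lam (rt b)) * L b x)) := by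
  rw [topDefect_eq_smul_doorGap, doorGap_eq_intertwiner_sandwich, intertwiner_eq_of_Dword]

end Summit.QuantumFields.BalabanUV.Beta.FP.TowerK2bDoorGapTelescope

end
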